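import Mathlib
import Summits.ValiantsHypothesis.ValiantsHypothesis.Theorems.ZeroOneTransfer.Negative.TopComponentFree
import Literature.Computability.AlgebraicComplexity.RealTauConjectureDepthFour
import Literature.Computability.AlgebraicComplexity.ArithCircuitProofs
import Literature.Computability.AlgebraicComplexity.PermanentIrreducible

/-!
# `DivisionGap.PerMultiplesHard` (stmt-ValiantsHypothesis-5068), line `uncharged-face-walk`:
the face descent lever (stub `stub_faceDescent`)

Let `w` be a weight on the cells of the `n × n` grid and `G ⊆ [n]²` the face it CUTS OUT: a
permutation lies inside `G` iff its `w`-weight `Σ_i w (σ i, i)` is maximal.  Let `h ≠ 0` be a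
multiplier over `ℝ≥0` whose top `w`-component has a single `G`-part `u` (every monomial of
`top_w h` agrees with `u` on `G`, and `u` lives on `G`).  Then

  `L⁺(x^u · per_G) ≤ L⁺(per_n · h) + 1`,   `per_G = Σ_{σ ⊆ G} x^{μ_σ}` the face permanent,

for the tree's monotone fan-in-two `complexity` over `ℝ≥0`.

Mechanism.
1. Over `ℝ≥0` top components are free (`complexity_topComponent_le`) and multiplicative
   (`topComponent_mul`): `L⁺(top_w per_n · top_w h) ≤ L⁺(per_n · h)`.
2. `top_w per_n = per_G` (`topComponent_perPoly_eq`): the `w`-weight of `x^{μ_σ}` is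
   `Σ_i w (σ i, i)` (`weight_permMonomial`), so it is the top weight of `per_n` iff it dominates the
   weight of every permutation iff (CutsOut) `σ ⊆ G`.
3. The projection `x_e ↦ x_e` (`e ∈ G`), `x_e ↦ 1` (`e ∉ G`) fixes `per_G` and collapses `top_w h`
   to `a · x^u`, `a = Σ coeff (top_w h) ≠ 0`; projections are free
   (`IsProjection.complexity_le_holds`), so `L⁺(a · x^u per_G) ≤ L⁺(per_n · h)`.
4. Rescaling by `a⁻¹` costs one gate (`complexity_smul_le_holds`).

Log (stub-worker): written from scratch on the `TopComponentFree` API; `weight_permMonomial` is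
adapted from `Cruxes/PerMultiplesHard/Disproof.lean`; the face computation
`topComponent_perPoly_eq` is the `CutsOut` form of `topForm_graph_perPoly` there. [folklore]
-/

noncomputable section

open MvPolynomial Literature.Computability.AlgebraicComplexity
open scoped NNReal BigOperators
open Summit.ValiantsHypothesis.ValiantsHypothesis.Theorems.ZeroOneTransfer.Negative

namespace Summit.ValiantsHypothesis.ValiantsHypothesis.Theorems.DivisionGap.PerMultiplesHard.FaceDescent

variable {n : ℕ}

/-! ### Weights of permutation monomials and the face permanent -/

-- adapted from Cruxes/PerMultiplesHard/Disproof.lean (`weight_permMonomial`)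
/-- The `w`-weight of the permutation monomial `x^{μ_ρ}` is `Σ_i w (ρ i, i)`. [folklore] -/
theorem weight_permMonomial (w : Fin n × Fin n → ℕ) (ρ : Equiv.Perm (Fin n)) :
    Finsupp.weight w (permMonomial ρ) = ∑ i, w (ρ i, i) := by
  change Finsupp.weight w (∑ i, Finsupp.single (ρ i, i) 1) = _
  rw [map_sum]
  exact Finset.sum_congr rfl fun i _ => by rw [Finsupp.weight_single, one_smul]

/-- Every permutation monomial occurs in `per_n` (with coefficient `1`). [folklore] -/
theorem permMonomial_mem_support_perPoly (ρ : Equiv.Perm (Fin n)) :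
    permMonomial ρ ∈ (perPoly (Fin n) ℝ≥0).support := by
  rw [mem_support_iff, coeff_permMonomial_perPoly]
  exact one_ne_zero

/-- If `w` cuts out `G`, a permutation monomial has the top `w`-weight of `per_n` iff the
permutation lies inside `G`. [folklore] -/
theorem weight_permMonomial_eq_iff (G : Finset (Fin n × Fin n)) (w : Fin n × Fin n → ℕ)
    (hcut : ∀ σ : Equiv.Perm (Fin n),
      (∀ i, (σ i, i) ∈ G) ↔ ∀ τ : Equiv.Perm (Fin n), (∑ i, w (τ i, i)) ≤ ∑ i, w (σ i, i))
    (ρ : Equiv.Perm (Fin n)) :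
    Finsupp.weight w (permMonomial ρ) = weightedTotalDegree w (perPoly (Fin n) ℝ≥0) ↔
      ∀ i, (ρ i, i) ∈ G := by
  rw [hcut ρ]
  constructor
  · intro h τ
    rw [← weight_permMonomial w τ, ← weight_permMonomial w ρ, h]
    exact le_weightedTotalDegree w (permMonomial_mem_support_perPoly τ)
  · intro h
    refine le_antisymm (le_weightedTotalDegree w (permMonomial_mem_support_perPoly ρ))
      (Finset.sup_le fun d hd => ?_)
    obtain ⟨τ, rfl⟩ :=
      exists_permMonomial_eq_of_coeff_perPoly_ne_zero ℝ≥0 (mem_support_iff.1 hd)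
    rw [weight_permMonomial, weight_permMonomial]
    exact h τ

/-- **The face permanent is the top component.**  If `w` cuts out `G` then
`top_w per_n = per_G = Σ_{σ ⊆ G} x^{μ_σ}`. [folklore] -/
theorem topComponent_perPoly_eq (G : Finset (Fin n × Fin n)) (w : Fin n × Fin n → ℕ)
    (hcut : ∀ σ : Equiv.Perm (Fin n),
      (∀ i, (σ i, i) ∈ G) ↔ ∀ τ : Equiv.Perm (Fin n), (∑ i, w (τ i, i)) ≤ ∑ i, w (σ i, i)) :
    topComponent w (perPoly (Fin n) ℝ≥0) =
      ∑ σ ∈ (Finset.univ : Finset (Equiv.Perm (Fin n))).filter (fun σ => ∀ i, (σ i, i) ∈ G),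
        monomial (permMonomial σ) (1 : ℝ≥0) := by
  classical
  refine MvPolynomial.ext _ _ fun d => ?_
  rw [coeff_topComponent, coeff_sum, Finset.sum_filter]
  simp only [coeff_monomial]
  by_cases hd : ∃ ρ : Equiv.Perm (Fin n), permMonomial ρ = d
  · obtain ⟨ρ, rfl⟩ := hd
    rw [coeff_permMonomial_perPoly, Finset.sum_eq_single ρ]
    · by_cases hρ : ∀ i, (ρ i, i) ∈ G
      · rw [if_pos ((weight_permMonomial_eq_iff G w hcut ρ).2 hρ), if_pos hρ, if_pos rfl]
      · rw [if_neg (fun h => hρ ((weight_permMonomial_eq_iff G w hcut ρ).1 h)), if_neg hρ]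
    · intro σ _ hσ
      rw [if_neg (permMonomial_injective.ne hσ), ite_self]
    · intro h
      exact absurd (Finset.mem_univ ρ) h
  · have h0 : coeff d (perPoly (Fin n) ℝ≥0) = 0 := by
      by_contra hne
      exact hd (exists_permMonomial_eq_of_coeff_perPoly_ne_zero ℝ≥0 hne)
    rw [h0, ite_self]
    symm
    exact Finset.sum_eq_zero fun σ _ => by rw [if_neg (fun h => hd ⟨σ, h⟩), ite_self]

/-- A permutation inside `G` has its monomial supported inside `G`. [folklore] -/
theorem support_permMonomial_subset {G : Finset (Fin n × Fin n)} {σ : Equiv.Perm (Fin n)}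
    (hσ : ∀ i, (σ i, i) ∈ G) : (permMonomial σ).support ⊆ G := by
  rintro ⟨r, c⟩ he
  rw [Finsupp.mem_support_iff, permMonomial_apply] at he
  by_cases h : σ c = r
  · subst h
    exact hσ c
  · rw [if_neg h] at he
    exact absurd rfl he

/-! ### The projection off `G` -/

/-- The projection `x_e ↦ x_e` (`e ∈ G`), `x_e ↦ 1` (`e ∉ G`) maps `c · x^d` to `c · x^{d'}`
whenever `d` agrees with `d'` on `G` and `d'` lives on `G`. [folklore] -/
theorem aeval_proj_monomial (G : Finset (Fin n × Fin n)) {d d' : (Fin n × Fin n) →₀ ℕ}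
    (hd' : d'.support ⊆ G) (hdd' : ∀ e ∈ G, d e = d' e) (c : ℝ≥0) :
    aeval (fun e => if e ∈ G then (X e : MvPolynomial (Fin n × Fin n) ℝ≥0) else 1)
        (monomial d c) = monomial d' c := by
  rw [aeval_monomial, algebraMap_eq, monomial_eq, Finsupp.prod_fintype _ _ (fun i => by simp),
    Finsupp.prod_fintype _ _ (fun i => by simp)]
  congr 1
  refine Finset.prod_congr rfl fun e _ => ?_
  by_cases he : e ∈ G
  · rw [if_pos he, hdd' e he]
  · have h0 : d' e = 0 := Finsupp.notMem_support_iff.1 fun h => he (hd' h)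
    rw [if_neg he, one_pow, h0, pow_zero]

/-- The projection collapses a polynomial with single `G`-part `u` onto `(Σ coeff) · x^u`.
[folklore] -/
theorem aeval_proj_of_single (G : Finset (Fin n × Fin n))
    {p : MvPolynomial (Fin n × Fin n) ℝ≥0} {u : (Fin n × Fin n) →₀ ℕ}
    (hu : u.support ⊆ G) (hp : ∀ m ∈ p.support, ∀ e ∈ G, m e = u e) :
    aeval (fun e => if e ∈ G then (X e : MvPolynomial (Fin n × Fin n) ℝ≥0) else 1) p =
      monomial u (∑ m ∈ p.support, coeff m p) := by
  conv_lhs => rw [p.as_sum]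
  rw [map_sum, map_sum]
  exact Finset.sum_congr rfl fun m hm => aeval_proj_monomial G hu (hp m hm) _

/-- Over `ℝ≥0` the coefficients of a nonzero polynomial have a nonzero sum. [folklore] -/
theorem sum_coeff_ne_zero {σ : Type*} {p : MvPolynomial σ ℝ≥0} (hp : p ≠ 0) :
    ∑ m ∈ p.support, coeff m p ≠ 0 := by
  obtain ⟨m, hm⟩ := support_nonempty.2 hp
  intro h
  exact (mem_support_iff.1 hm) (Finset.sum_eq_zero_iff.1 h m hm)

/-! ### The stub -/

/-- **Face descent (stub `stub_faceDescent` of line `uncharged-face-walk`).**  If `w` cuts out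
the face `G`, `h ≠ 0`, and the top `w`-component of `h` has the single `G`-part `u`, then
`L⁺(x^u · per_G) ≤ L⁺(per_n · h) + 1`: pass to top components (free and multiplicative over
`ℝ≥0`, `top_w per_n = per_G`), project the variables off `G` to `1` (free; `per_G` is fixed and
`top_w h ↦ a · x^u`, `a ≠ 0`), rescale by `a⁻¹` (one gate). [folklore] -/
theorem stub_faceDescent :
    ∀ (n : ℕ) (G : Finset (Fin n × Fin n)) (w : Fin n × Fin n → ℕ)
      (h : MvPolynomial (Fin n × Fin n) ℝ≥0) (u : (Fin n × Fin n) →₀ ℕ),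
      (∀ σ : Equiv.Perm (Fin n),
        (∀ i, (σ i, i) ∈ G) ↔ ∀ τ : Equiv.Perm (Fin n), (∑ i, w (τ i, i)) ≤ ∑ i, w (σ i, i)) →
      h ≠ 0 →
      (u.support ⊆ G ∧ ∀ m ∈ (topComponent w h).support, ∀ e ∈ G, m e = u e) →
      complexity (monomial u (1 : ℝ≥0) *
          ∑ σ ∈ (Finset.univ : Finset (Equiv.Perm (Fin n))).filter (fun σ => ∀ i, (σ i, i) ∈ G),
            monomial (permMonomial σ) (1 : ℝ≥0)) ≤
        complexity (perPoly (Fin n) ℝ≥0 * h) + 1 := by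
  intro n G w h u hcut hh hu
  classical
  set perG : MvPolynomial (Fin n × Fin n) ℝ≥0 :=
    ∑ σ ∈ (Finset.univ : Finset (Equiv.Perm (Fin n))).filter (fun σ => ∀ i, (σ i, i) ∈ G),
      monomial (permMonomial σ) (1 : ℝ≥0) with hperG
  set a : ℝ≥0 := ∑ m ∈ (topComponent w h).support, coeff m (topComponent w h)
  have ha : a ≠ 0 := sum_coeff_ne_zero (topComponent_ne_zero w hh)
  -- (1) top components are free and multiplicative; `top_w per_n = per_G`
  have h1 : complexity (perG * topComponent w h) ≤ complexity (perPoly (Fin n) ℝ≥0 * h) := by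
    rw [hperG, ← topComponent_perPoly_eq G w hcut, ← topComponent_mul]
    exact complexity_topComponent_le w _
  -- (2) the projection off `G` fixes `per_G` and collapses `top_w h` to `a · x^u`
  have hprjG : aeval (fun e => if e ∈ G then (X e : MvPolynomial (Fin n × Fin n) ℝ≥0) else 1)
      perG = perG := by
    rw [hperG, map_sum]
    refine Finset.sum_congr rfl fun σ hσ => ?_
    exact aeval_proj_monomial G (support_permMonomial_subset (Finset.mem_filter.1 hσ).2)
      (fun e _ => rfl) 1
  have hprjT : aeval (fun e => if e ∈ G then (X e : MvPolynomial (Fin n × Fin n) ℝ≥0) else 1)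
      (topComponent w h) = monomial u a :=
    aeval_proj_of_single G hu.1 hu.2
  have hproj : IsProjection (a • (monomial u (1 : ℝ≥0) * perG)) (perG * topComponent w h) := by
    refine ⟨fun e => if e ∈ G then X e else 1, fun e => ?_, ?_⟩
    · by_cases he : e ∈ G
      · exact Or.inl ⟨e, if_pos he⟩
      · refine Or.inr ⟨1, ?_⟩
        show (if e ∈ G then X e else 1) = C 1
        rw [if_neg he, C_1]
    · rw [map_mul, hprjG, hprjT, ← smul_mul_assoc, smul_monomial, smul_eq_mul, mul_one]
      exact mul_comm _ _
  have h2 : complexity (a • (monomial u (1 : ℝ≥0) * perG)) ≤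
      complexity (perG * topComponent w h) :=
    IsProjection.complexity_le_holds hproj
  -- (3) rescale by `a⁻¹`
  have h3 : complexity (monomial u (1 : ℝ≥0) * perG) ≤
      complexity (a • (monomial u (1 : ℝ≥0) * perG)) + 1 := by
    have h := complexity_smul_le_holds a⁻¹ (a • (monomial u (1 : ℝ≥0) * perG))
    rwa [inv_smul_smul₀ ha] at h
  omega

end Summit.ValiantsHypothesis.ValiantsHypothesis.Theorems.DivisionGap.PerMultiplesHard.FaceDescent

end
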